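import Summits.HodgeConjecture.HodgeConjecture.Theorems.CyclicUnitaryPowersK1OfLocalMonodromyPrintNumbers
import Summits.HodgeConjecture.HodgeConjecture.Theorems.CyclicUnitaryPowersEigenHodgeNumbersOfTwoNumbers
import Literature.AlgebraicGeometry.HodgeTheory.SmoothSurfaceSecondBettiNumber

/-!
# K1 `VeryGeneralDeckCommutatorsInHg` of route `CyclicUnitaryPowers` from THREE cited facts: the σ-free local monodromy of the
# `A_{p−1}` degeneration (F1†), ONE textbook number (`h^{2,0}` of a smooth hypersurface, PG) and the CDK cover
# (stmt-HodgeConjecture-19544; the binder B2 `b₂ = d³ − 4d² + 6d − 2` is now a THEOREM)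

Prover seat `hodge-nonav-prover-Bx` (g10), cell `hodge-nonav`. Landed `--supports stmt-HodgeConjecture-19544`; sorry-free, no
definition, no new named fact. CONDITIONAL results; nothing here says HC ∕ HC_AV is proved; rung F-H1 is not moved.

The registry-v14 end state of K1-A was `{F1†, PG, B2, CDK}` (Ax g9 `veryGeneralDeckCommutatorsInHg_of_localMonodromy_printNumbers`,
p618210, joining Bx g9 `veryGeneralDeckCommutatorsInHg_of_prime_family_printNumbers`). The binder B2 =
`EisenbudHarris2016_surface_secondBettiNumber` (`b₂` of every smooth surface of degree `d` in `ℙ³`) is DISCHARGED by the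
Literature theorem `EisenbudHarris2016_surface_secondBettiNumber_holds` (file `SmoothSurfaceSecondBettiNumber`: Ehresmann on the
universal smooth hypersurface — `b₂` is constant over the path-connected parameter space, `SmoothHypersurfaceBettiNumbersConstant` —
and the Fermat value from Shioda's character decomposition, `FermatEvenMiddleBettiNumber`; all tree theorems). This file feeds it
in:

* **`finrank_eigenspace_inf_hodgePiece_prime_of_geometricGenus (hA : PG)`** — CT2's eigen-Hodge numbers of the deck transformation
  at primes `p ≥ 5` from PG ALONE (`finrank_eigenspace_inf_hodgePiece_prime_of_facts hA B2_holds`);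
* **`veryGeneralDeckCommutatorsInHg_of_localMonodromy_geometricGenus (hF1 : F1†) (hPG : PG) (hCDK : CDK)`** and the leaf twin
  `cyclicSurfacePowersHodge_of_localMonodromy_geometricGenus` — **K1-A ⟸ {F1†, PG, CDK}**;
* `veryGeneralDeckCommutatorsInHg_of_nodalMeridian_geometricGenus (H1 : F1°) (hPG) (hCDK)` — the same on the F1° road
  (`carlsonToledo1999_nodalMeridianMonodromy_isCyclicReflection`), for the record.

## References

* [CarlsonToledo1999] J. A. Carlson, D. Toledo, Duke Math. J. 97 (1999), §2, §3, §5, §6, §7 Theorem 7.1.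
* [CattaniDeligneKaplan1995] E. Cattani, P. Deligne, A. Kaplan, J. Amer. Math. Soc. 8 (1995), Thm. 1.1, Cor. 1.2.
* [Arapura2012] D. Arapura, Algebraic Geometry over the Complex Numbers, §17.3 (17.3.1).
* [EisenbudHarris2016] D. Eisenbud, J. Harris, 3264 and All That, Ex. 5.24 / Table 5.1 (now a theorem in the tree).
-/

noncomputable section


set_option linter.dupNamespace false

namespace Summit.HodgeConjecture.HodgeConjecture.Theorems.CyclicUnitaryPowersK1OfLocalMonodromyGeometricGenus

open MvPolynomial
open Literature.AlgebraicGeometry.Motives Literature.AlgebraicGeometry.HodgeTheory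
open Literature.RingTheory.MvPolynomial (idealDegree)
open Summit.HodgeConjecture.HodgeConjecture.Theorems.CyclicUnitaryPowersK1OfPrintNumbers
open Summit.HodgeConjecture.HodgeConjecture.Theorems.CyclicUnitaryPowersK1OfLocalMonodromyPrintNumbers
open Summit.HodgeConjecture.HodgeConjecture.Theorems.CyclicUnitaryPowersEigenHodgeNumbersOfTwoNumbers

/-- **CT2's eigen-Hodge numbers at primes `p ≥ 5` from PG alone**: for a smooth cyclic cover `X : x₃^p = f(x₀,x₁,x₂)`,
`dim (E_{ζ^i}(σ^*) ∩ H^{2−q,q}) = dim R(f)_{(q+1)p−3−i}` for `1 ≤ i < p`, `q ≤ 2` — the tree's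
`finrank_eigenspace_inf_hodgePiece_prime_of_facts` with its B2 hypothesis discharged by
`EisenbudHarris2016_surface_secondBettiNumber_holds`. CONDITIONAL on PG (`Arapura2012_hypersurface_geometricGenus`).
[cite: CarlsonToledo1999, §5] [cite: Arapura2012, §17.3 (17.3.1)] -/
theorem finrank_eigenspace_inf_hodgePiece_prime_of_geometricGenus (hA : Arapura2012_hypersurface_geometricGenus)
    (hHD : exists_isReal_hodgeModel) {p : ℕ} (hp : p.Prime) (hp5 : 5 ≤ p) (f : MvPolynomial (Fin 3) ℂ)
    (hf : f.IsHomogeneous p) (hf0 : f ≠ 0)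
    (hX : IsSmoothProjective 2 (SmoothHypersurface.hypersurface (cyclicCoverForm p f)))
    (ha : deckUnit p ∈ diagonalStabilizer (cyclicCoverForm p f))
    (i q : ℕ) (hi : 1 ≤ i) (hip : i < p) (hq : q ≤ 2) :
    Module.finrank ℂ ↥(Module.End.eigenspace
        ((BettiUniverse.pull (diagonalAut (cyclicCoverForm p f) ha) 2).baseChange ℂ)
        (Complex.exp (2 * (Real.pi : ℂ) * Complex.I / (p : ℂ)) ^ i) ⊓
      (BettiUniverse.hodge hHD hX 2).piece ((2 : ℤ) - q) q) =
    if (q + 1) * p < 3 + i then 0 else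
      Module.finrank ℂ ↥(homogeneousSubmodule (Fin 3) ℂ ((q + 1) * p - 3 - i)) -
        Module.finrank ℂ ↥(idealDegree (UniversalHypersurface.jacobianIdeal f) ((q + 1) * p - 3 - i)) :=
  finrank_eigenspace_inf_hodgePiece_prime_of_facts hA EisenbudHarris2016_surface_secondBettiNumber_holds hHD hp hp5 f
    hf hf0 hX ha i q hi hip hq

/-- **K1 `VeryGeneralDeckCommutatorsInHg` from THREE cited facts** — F1† (`carlsonToledo1999_nodalMeridianLocalMonodromy`: the
σ-free local monodromy of the `A_{p−1}` degeneration at a one-nodal branch curve), PG (`h^{n,0}` of a smooth hypersurface),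
CDK (the Cattani–Deligne–Kaplan cover); the fourth binder of the v14 end state, B2 (`b₂` of a smooth surface in `ℙ³`), is the
tree's theorem `EisenbudHarris2016_surface_secondBettiNumber_holds`. CONDITIONAL; nothing here says HC ∕ HC_AV is proved.
[cite: CarlsonToledo1999, §2, §5, §6 (kdoublept), §7 Theorem 7.1] [cite: CattaniDeligneKaplan1995, Thm. 1.1 and Cor. 1.2]
[cite: Arapura2012, §17.3 (17.3.1)] -/
theorem veryGeneralDeckCommutatorsInHg_of_localMonodromy_geometricGenus
    (hF1 : carlsonToledo1999_nodalMeridianLocalMonodromy)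
    (hPG : Arapura2012_hypersurface_geometricGenus)
    (hCDK : cmsp_nonHodgeGenericPoints_countable_algebraic_cover) :
    Summit.HodgeConjecture.HodgeConjecture.Theses.CyclicUnitaryPowers.VeryGeneralDeckCommutatorsInHg :=
  veryGeneralDeckCommutatorsInHg_of_localMonodromy_printNumbers hF1 hPG
    EisenbudHarris2016_surface_secondBettiNumber_holds @hCDK

/-- **The rung leaf `CyclicSurfacePowersHodge` (stmt-HodgeConjecture-19543) from the same THREE facts** (via the landed fact-free
step `cyclicSurfacePowersHodge_of_veryGeneralDeckCommutatorsInHg`). CONDITIONAL; rung F-H1 not moved.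
[cite: CarlsonToledo1999, §2, §5, §6 (kdoublept), §7 Theorem 7.1] [cite: CattaniDeligneKaplan1995, Thm. 1.1 and Cor. 1.2] -/
theorem cyclicSurfacePowersHodge_of_localMonodromy_geometricGenus
    (hF1 : carlsonToledo1999_nodalMeridianLocalMonodromy)
    (hPG : Arapura2012_hypersurface_geometricGenus)
    (hCDK : cmsp_nonHodgeGenericPoints_countable_algebraic_cover) :
    Summit.HodgeConjecture.HodgeConjecture.Theses.CyclicUnitaryPowers.CyclicSurfacePowersHodge :=
  CyclicUnitaryPowersCyclicSurfacePowersHodge.cyclicSurfacePowersHodge_of_veryGeneralDeckCommutatorsInHg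
    (veryGeneralDeckCommutatorsInHg_of_localMonodromy_geometricGenus @hF1 @hPG @hCDK)

/-- **The F1° road, for the record**: K1 from F1° (`carlsonToledo1999_nodalMeridianMonodromy_isCyclicReflection`), PG and CDK
(`veryGeneralDeckCommutatorsInHg_of_nodalMeridian_printNumbers` with B2 discharged). CONDITIONAL.
[cite: CarlsonToledo1999, §5, §6 (kdoublept) and Proposition, §7 Thm. 7.1] [cite: CattaniDeligneKaplan1995, Thm. 1.1 and Cor. 1.2] -/
theorem veryGeneralDeckCommutatorsInHg_of_nodalMeridian_geometricGenus
    (H1 : carlsonToledo1999_nodalMeridianMonodromy_isCyclicReflection)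
    (hPG : Arapura2012_hypersurface_geometricGenus)
    (hCDK : cmsp_nonHodgeGenericPoints_countable_algebraic_cover) :
    Summit.HodgeConjecture.HodgeConjecture.Theses.CyclicUnitaryPowers.VeryGeneralDeckCommutatorsInHg :=
  veryGeneralDeckCommutatorsInHg_of_nodalMeridian_printNumbers H1 hPG EisenbudHarris2016_surface_secondBettiNumber_holds @hCDK

end Summit.HodgeConjecture.HodgeConjecture.Theorems.CyclicUnitaryPowersK1OfLocalMonodromyGeometricGenus

end
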